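import Summits.CriticalPhenomena.PercolationContinuityZ3.Theorems.PercNearOneGluingNoHeavyQuantTwinMove
import Summits.CriticalPhenomena.PercolationContinuityZ3.Theorems.PercNearOneGluingNoHeavyQuantFlowTransfer
import Summits.CriticalPhenomena.PercolationContinuityZ3.Theorems.PercNearOneGluingNoHeavyQuantFlowPour
import Summits.CriticalPhenomena.PercolationContinuityZ3.Theorems.PercNearOneGluingNoHeavyQuantZeroLast
import HarnessLib

/-!
# QUANT lane R8, T-DEC, leg (III): THE TWIN MOVE LEMMA WHEN THE BLOB ATOM RIDES THE GIANTS — `TwinMoveDEC` at every layer `j ≥ a` with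
# `2a < t`, for every flow witness of `Λ` in which the atom `a` sends nothing into mids (`twinMove_of_blobOnGiants`)

builds on p205010 (kernel theorem, internal audit signed; external expert review pending)

Support file (`--supports stmt-CriticalPhenomena-4575`), QUANT lane seat prim-quant-arm-1 (gen 39), rung R8 of
`run/shared/lean/prim/quant/LADDER.md`.  Theorems only (no definitions), standard axioms, no sorries.  Assembles this seat's chain:
`transfer_partialRouting` (`…QuantFlowTransfer`) → `IsFlowAtT.pour` (`…QuantFlowPour`) → `decAtT_of_zeroFreeRouting` (`…QuantZeroLast`, itself
= giant-minimal NF `…QuantFlowGiantMin` + the exact dichotomy `…QuantIncomeDichotomy` of the income criterion `…QuantIncomeCriterion`).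
Memo `run/shared/lean/prim/quant/prim-quant-arm-1-g39/TWIN-MOVE-G39.md` §9.

THE THEOREM.  TwinMove data: `0 < y < 1`, `0 ≤ z < 1`, `0 < g`, `y ≤ (1−z)g`, `R ≥ 0` a probability law on `{0..N}` (any twins — they are
not used here), `P = z·δ₀ + (1−z)·R` at its mean `t = (1−z)·S` with `y·N ≤ t`, `Λ = z·{0,a;g} + (1−z)·R` at `τ = t + zag`; the layer `j ≥ a`
and `2a < t` (the atom `a` is a low of both laws).  HYPOTHESIS: a flow witness `f` of `Λ` at `(y, τ, j, N)` with `f a m = 0` for every `m ≤ j`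
(the blob atom's mass rides the giants only — e.g. the giant-first normal form of typer g27 whenever it succeeds completely).  CONCLUSION:
`DECAtT y t j N P`.  PROOF: transfer `f` to a routing `φ` of `P`'s nonzero lows at `t` (rates drop, rows shrink at `a` by the factor `P a/Λ a`);
pour the fraction `κ = min(1, F₀/W)` of its giant-routed mass `W` into the zero's vacated mid slots (capacity `usage_τ(0,m)·f(0,m)`, where every
nonzero low is cheaper than the zero was: `rho_le_rho_zero`), gaining `min(W, F₀)`; the resulting routing either uses no giant or has giant mass
`W − F₀`, and then `y/(1−y)·(P 0 + W − F₀) ≤ y/(1−y)·(W₀′ + Σ_{l≥1} G_l) ≤ P(G)` because `P 0 = F₀ + W₀′ + zg` and the transfer dropped exactly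
`zg` of `a`'s (all-giant) mass; the zero-last principle finishes.  The residual of `TwinMoveDEC` (j ≥ a) is thus: flows of `Λ` in which `a` must
send mass into mids (typer g27's sub-case (b)), and the layers with `2a ≥ t` (overflow at the mid `a`, twin re-routing).

* **`LawDec.twinMove_of_blobOnGiants`**.

[this work]; nothing here is cited as a published result.  The gluing rows served [cite: KozmaNitzan2024, Conjecture 3 (p. 15)]; product measure
[cite: Grimmett1999, §1.3 p. 10].
-/

noncomputable section

namespace Summit.CriticalPhenomena.PercolationContinuityZ3.Theorems

namespace Quant

open Finset

/-- the two-point law `{lo, hi; g}` (as in `…QuantLawDEC`) -/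
local notation3 "TP[" lo ", " hi ", " g ", " h "]" =>
  (g : ℝ) * (if (h : ℕ) = (hi : ℕ) then (1 : ℝ) else 0) + (1 - (g : ℝ)) * (if (h : ℕ) = (lo : ℕ) then (1 : ℝ) else 0)

namespace LawDec

set_option maxHeartbeats 400000 in
/-- **TWIN MOVE WHEN THE BLOB ATOM RIDES THE GIANTS.**  See the module docstring. [this work] -/
theorem twinMove_of_blobOnGiants (y z g : ℝ) (a j N : ℕ) (R : ℕ → ℝ) (f : ℕ → ℕ → ℝ)
    (hy0 : 0 < y) (hy1 : y < 1) (hz0 : 0 ≤ z) (hz1 : z < 1) (hg0 : 0 < g) (hg1 : g ≤ 1) (ha1 : 1 ≤ a)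
    (hR0 : ∀ h, 0 ≤ R h) (hRN : ∀ h, N < h → R h = 0) (hR1 : ∑ h ∈ Finset.range (N + 1), R h = 1)
    (hta : y * (N : ℝ) ≤ (1 - z) * ∑ h ∈ Finset.range (N + 1), (h : ℝ) * R h)
    (hat : 2 * (a : ℝ) < (1 - z) * ∑ h ∈ Finset.range (N + 1), (h : ℝ) * R h) (haj : a ≤ j)
    (hf : IsFlowAtT y (z * (a : ℝ) * g + (1 - z) * ∑ h ∈ Finset.range (N + 1), (h : ℝ) * R h) j N
      (fun h => z * TP[0, a, g, h] + (1 - z) * R h) f)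
    (hagiant : ∀ m, m ≤ j → f a m = 0) :
    DECAtT y ((1 - z) * ∑ h ∈ Finset.range (N + 1), (h : ℝ) * R h) j N
      (fun h => z * (if h = 0 then (1 : ℝ) else 0) + (1 - z) * R h) := by
  classical
  set S : ℝ := ∑ h ∈ Finset.range (N + 1), (h : ℝ) * R h with hS
  set t : ℝ := (1 - z) * S with ht
  set τ : ℝ := z * (a : ℝ) * g + (1 - z) * S with hτ
  set Λ : ℕ → ℝ := fun h => z * TP[0, a, g, h] + (1 - z) * R h with hΛ
  set P : ℕ → ℝ := fun h => z * (if h = 0 then (1 : ℝ) else 0) + (1 - z) * R h with hP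
  have h1z : 0 < 1 - z := by linarith
  have h1y : 0 < 1 - y := by linarith
  have ha0 : (0 : ℝ) ≤ a := Nat.cast_nonneg a
  have hane : a ≠ 0 := by omega
  have hzg : 0 ≤ z * g := mul_nonneg hz0 hg0.le
  have hzag : 0 ≤ z * (a : ℝ) * g := mul_nonneg (mul_nonneg hz0 ha0) hg0.le
  have htτ : t ≤ τ := by rw [ht, hτ]; linarith
  have ht0 : 0 < t := by rw [ht]; nlinarith
  have huG : 0 < y / (1 - y) := div_pos hy0 h1y
  -- facts about `P`
  have hP0 : ∀ h, 0 ≤ P h := fun h => by simp only [hP]; split_ifs <;> nlinarith [hR0 h]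
  have hPN : ∀ h, N < h → P h = 0 := fun h hh => by simp only [hP]; rw [hRN h hh, if_neg (by omega)]; ring
  have hP1 : ∑ h ∈ Finset.range (N + 1), P h = 1 := by
    simp only [hP]
    rw [Finset.sum_add_distrib, ← Finset.mul_sum, ← Finset.mul_sum, hR1, Finset.sum_ite_eq' (Finset.range (N + 1)) 0,
      if_pos (Finset.mem_range.2 (Nat.succ_pos N))]
    ring
  have hPmean : ∑ h ∈ Finset.range (N + 1), (h : ℝ) * P h = t := by
    simp only [hP]
    have e : ∀ h : ℕ, (h : ℝ) * (z * (if h = 0 then (1 : ℝ) else 0) + (1 - z) * R h)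
        = (if h = 0 then (h : ℝ) * z else 0) + (1 - z) * ((h : ℝ) * R h) := fun h => by split_ifs <;> ring
    simp_rw [e]
    rw [Finset.sum_add_distrib, ← Finset.mul_sum, Finset.sum_ite_eq' (Finset.range (N + 1)) 0, if_pos (Finset.mem_range.2 (Nat.succ_pos N))]
    simp [ht, hS]
  -- values at the special atoms
  have hΛa : Λ a = z * g + (1 - z) * R a := by
    show z * (g * (if a = a then (1:ℝ) else 0) + (1 - g) * (if a = 0 then (1:ℝ) else 0)) + (1 - z) * R a = _
    rw [if_pos rfl, if_neg hane]; ring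
  have hPa : P a = (1 - z) * R a := by
    show z * (if a = 0 then (1:ℝ) else 0) + (1 - z) * R a = _
    rw [if_neg hane]; ring
  have hΛ0 : Λ 0 = z * (1 - g) + (1 - z) * R 0 := by
    show z * (g * (if (0:ℕ) = a then (1:ℝ) else 0) + (1 - g) * (if (0:ℕ) = 0 then (1:ℝ) else 0)) + (1 - z) * R 0 = _
    rw [if_neg (Ne.symm hane), if_pos rfl]; ring
  have hP00 : P 0 = z + (1 - z) * R 0 := by
    show z * (if (0:ℕ) = 0 then (1:ℝ) else 0) + (1 - z) * R 0 = _
    rw [if_pos rfl]; ring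
  have hΛP : ∀ h, h ≠ 0 → h ≠ a → Λ h = P h := by
    intro h h0 ha; simp only [hΛ, hP, if_neg h0, if_neg ha]; ring
  have hΛnn : ∀ h, 0 ≤ Λ h := fun h => by
    simp only [hΛ]; split_ifs <;> nlinarith [hR0 h, mul_nonneg hz0 (sub_nonneg.2 hg1), mul_nonneg hz0 hg0.le]
  have hPΛa : P a = Λ a - z * g := by rw [hPa, hΛa]; ring
  obtain ⟨hf0, hfsupp, hfrow, hfcol⟩ := id hf
  -- (1) rows shrink
  have hrows : ∀ l : ℕ, 1 ≤ l → l ≤ j → 2 * (l : ℝ) < t → 0 ≤ P l ∧ P l ≤ Λ l := by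
    intro l h1 _ _
    refine ⟨hP0 l, ?_⟩
    by_cases hla : l = a
    · rw [hla, hPΛa]; linarith
    · rw [hΛP l (by omega) hla]
  -- (2) the transfer
  obtain ⟨hφ0, hφsupp, hφrow, hφcol⟩ := transfer_partialRouting y t τ j N Λ P f hy0 hy1 htτ hf hrows
  set φ : ℕ → ℕ → ℝ := fun l h => if (1 ≤ l ∧ 2 * (l : ℝ) < t) then P l / Λ l * f l h else 0 with hφ
  have hφzero : ∀ h, φ 0 h = 0 := fun h => by simp only [hφ]; rw [if_neg (by omega)]
  -- (3) termwise comparison of loads (replayed from `transfer_partialRouting`)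
  have hpair : ∀ l h, 0 < f l h → l ≤ j ∧ 2 * (l : ℝ) < τ ∧ h ≤ N ∧ (j + 1 ≤ h ∨ τ < (l : ℝ) + h) ∧ l < h := by
    intro l h hp
    obtain ⟨hlj, hl2, hhM, hc⟩ := hfsupp l h hp
    refine ⟨hlj, hl2, hhM, hc, ?_⟩
    rcases hc with hc | hc
    · omega
    · have : (l : ℝ) < h := by linarith
      exact_mod_cast this
  have huτ0 : ∀ l h, 0 ≤ usage y τ j l h * f l h := by
    intro l h
    rcases (hf0 l h).eq_or_lt with hz | hp
    · rw [← hz, mul_zero]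
    · obtain ⟨_, hl2, _, hc, hlh⟩ := hpair l h hp
      exact mul_nonneg (usage_pos_of_compat y τ j l h hy0 hy1 hl2 hlh hc).le hp.le
  have hterm : ∀ l h, usage y t j l h * φ l h ≤ usage y τ j l h * f l h := by
    intro l h
    simp only [hφ]
    by_cases hc : (1 ≤ l ∧ 2 * (l : ℝ) < t)
    · rw [if_pos hc]
      rcases (hf0 l h).eq_or_lt with hz | hfp
      · rw [← hz, mul_zero, mul_zero, mul_zero]
      · obtain ⟨hlj, hl2, _, hcomp, hlh⟩ := hpair l h hfp
        have hcompt : j + 1 ≤ h ∨ t < (l : ℝ) + h := by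
          rcases hcomp with h1 | h2
          · exact Or.inl h1
          · exact Or.inr (lt_of_le_of_lt htτ h2)
        have hut0 : 0 ≤ usage y t j l h := (usage_pos_of_compat y t j l h hy0 hy1 hc.2 hlh hcompt).le
        have hmono : usage y t j l h ≤ usage y τ j l h := by
          by_cases hg : j + 1 ≤ h
          · rw [usage_giant_eq y t j l h hg, usage_giant_eq y τ j l h hg]
          · exact usage_le_of_rho_le y t τ j l l h hy0 hy1 (by omega) hl2 (hcomp.resolve_left hg)
              (rho_le_of_target_le t τ l h hlh htτ)
        obtain ⟨hPl0, hPlΛ⟩ := hrows l hc.1 hlj hc.2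
        have hθ : 0 ≤ P l / Λ l ∧ P l / Λ l ≤ 1 := by
          rcases lt_or_ge 0 (Λ l) with hΛl | hΛl
          · exact ⟨div_nonneg hPl0 hΛl.le, (div_le_one hΛl).2 hPlΛ⟩
          · have : P l = 0 := le_antisymm (hPlΛ.trans hΛl) hPl0
            rw [this, zero_div]; exact ⟨le_rfl, zero_le_one⟩
        calc usage y t j l h * (P l / Λ l * f l h)
            = (usage y t j l h * (P l / Λ l)) * f l h := by ring
          _ ≤ (usage y τ j l h * 1) * f l h :=
              mul_le_mul_of_nonneg_right (mul_le_mul hmono hθ.2 hθ.1 (hut0.trans hmono)) hfp.le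
          _ = usage y τ j l h * f l h := by ring
    · rw [if_neg hc, mul_zero]; exact huτ0 l h
  -- `Λ`'s column bound at every `t`-absorber
  have hcolΛ : ∀ h, h ≤ N → (j + 1 ≤ h ∨ t ≤ 2 * (h : ℝ)) → ∑ l ∈ Finset.range (j + 1), usage y τ j l h * f l h ≤ Λ h := by
    intro h hhN habs
    by_cases hτh : j + 1 ≤ h ∨ τ ≤ 2 * (h : ℝ)
    · exact hfcol h hhN hτh
    · obtain ⟨hτ1, hτ2⟩ := not_or.1 hτh
      have hτ2' : 2 * (h : ℝ) < τ := not_le.1 hτ2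
      have : ∑ l ∈ Finset.range (j + 1), usage y τ j l h * f l h = 0 := Finset.sum_eq_zero fun l _ => by
        rcases (hf0 l h).eq_or_lt with hz | hp
        · rw [← hz, mul_zero]
        · exfalso
          obtain ⟨_, hl2, _, hc, _⟩ := hpair l h hp
          rcases hc with hc | hc
          · exact hτ1 hc
          · linarith
      rw [this]; exact hΛnn h
  -- (4) `φ` is a routing of the nonzero lows of `P`
  have hφP0 : IsFlowAtT y t j N (fun h => if h = 0 then 0 else P h) φ := by
    refine ⟨hφ0, fun l h hp => ?_, fun l hlj hlow => ?_, fun h hhN habs => ?_⟩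
    · obtain ⟨hl, hhM, hc⟩ := hφsupp l h hp
      exact ⟨hl.2.1, hl.2.2, hhM, hc⟩
    · show ∑ h ∈ Finset.range (N + 1), φ l h = (if l = 0 then 0 else P l)
      by_cases hl0 : l = 0
      · subst hl0; rw [if_pos rfl]; exact Finset.sum_eq_zero fun h _ => hφzero h
      · rw [if_neg hl0]; exact hφrow l (Nat.one_le_iff_ne_zero.2 hl0) hlj hlow
    · show ∑ l ∈ Finset.range (j + 1), usage y t j l h * φ l h ≤ (if h = 0 then 0 else P h)
      have hh0 : h ≠ 0 := by
        rcases habs with h1 | h2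
        · omega
        · intro he; rw [he] at h2; simp at h2; linarith
      have hha : h ≠ a := by
        rcases habs with h1 | h2
        · omega
        · intro he; rw [he] at h2; linarith
      rw [if_neg hh0, ← hΛP h hh0 hha]
      exact (Finset.sum_le_sum fun l _ => hterm l h).trans (hcolΛ h hhN habs)
  -- (5) the zero's slots
  have hslotfacts : ∀ h, h ≤ j → 0 < f 0 h → h ≤ N ∧ τ < (h : ℝ) ∧ 0 < usage y τ j 0 h := by
    intro h hhj hp
    obtain ⟨_, _, hhN, hc, hlh⟩ := hpair 0 h hp
    have hc' : τ < (h : ℝ) := by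
      rcases hc with hc | hc
      · omega
      · simpa using hc
    exact ⟨hhN, hc', usage_pos_of_compat y τ j 0 h hy0 hy1 (by simp; linarith) hlh (Or.inr (by simpa using hc'))⟩
  set s : ℕ → ℝ := fun h => if (h ≤ j ∧ 0 < f 0 h) then usage y τ j 0 h * f 0 h else 0 with hs
  set U : ℕ → ℝ := fun h => if (h ≤ j ∧ 0 < f 0 h) then usage y τ j 0 h else 1 with hUdef
  have hs0 : ∀ h, 0 ≤ s h := fun h => by
    simp only [hs]; split_ifs with hc
    · exact mul_nonneg (hslotfacts h hc.1 hc.2).2.2.le hc.2.le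
    · exact le_rfl
  have hU : ∀ h, 0 < U h := fun h => by
    simp only [hUdef]; split_ifs with hc
    · exact (hslotfacts h hc.1 hc.2).2.2
    · exact zero_lt_one
  have hsguard : ∀ h, 0 < s h → h ≤ j ∧ 0 < f 0 h := by
    intro h hp; simp only [hs] at hp
    by_contra hc; rw [if_neg hc] at hp; exact lt_irrefl _ hp
  have hslot : ∀ h, 0 < s h → h ≤ j ∧ h ≤ N ∧ t < (h : ℝ) := by
    intro h hp
    obtain ⟨hhj, hf0h⟩ := hsguard h hp
    obtain ⟨hhN, hτh, _⟩ := hslotfacts h hhj hf0h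
    exact ⟨hhj, hhN, lt_of_le_of_lt htτ hτh⟩
  have hspare : ∀ h, 0 < s h → ∑ l ∈ Finset.range (j + 1), usage y t j l h * φ l h + s h ≤ (fun h => if h = 0 then 0 else P h) h := by
    intro h hp
    obtain ⟨hhj, hf0h⟩ := hsguard h hp
    obtain ⟨hhN, hτh, _⟩ := hslotfacts h hhj hf0h
    have hh0 : h ≠ 0 := by rintro rfl; simp at hτh; linarith
    have hha : h ≠ a := by rintro rfl; linarith
    have hsval : s h = usage y τ j 0 h * f 0 h := by simp only [hs, if_pos (And.intro hhj hf0h)]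
    show ∑ l ∈ Finset.range (j + 1), usage y t j l h * φ l h + s h ≤ (if h = 0 then 0 else P h)
    rw [if_neg hh0, ← hΛP h hh0 hha, hsval]
    -- split the zero term off `Λ`'s column
    have hcol := hcolΛ h hhN (Or.inr (by linarith))
    have h0mem : (0:ℕ) ∈ Finset.range (j + 1) := Finset.mem_range.2 (Nat.succ_pos j)
    rw [← Finset.add_sum_erase _ _ h0mem] at hcol
    have hrest : ∑ l ∈ Finset.range (j + 1), usage y t j l h * φ l h
        ≤ ∑ l ∈ (Finset.range (j + 1)).erase 0, usage y τ j l h * f l h := by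
      rw [← Finset.add_sum_erase _ _ h0mem, hφzero, mul_zero, zero_add]
      exact Finset.sum_le_sum fun l _ => hterm l h
    linarith
  have hrate : ∀ l h, 0 < s h → l ≤ j → 2 * (l : ℝ) < t → usage y t j l h ≤ U h := by
    intro l h hp hlj hlow
    obtain ⟨hhj, hf0h⟩ := hsguard h hp
    obtain ⟨hhN, hτh, _⟩ := hslotfacts h hhj hf0h
    have hUval : U h = usage y τ j 0 h := by simp only [hUdef, if_pos (And.intro hhj hf0h)]
    rw [hUval]
    refine usage_le_of_rho_le y t τ j l 0 h hy0 hy1 hhj (by simp; linarith) (by simpa using hτh) ?_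
    exact rho_le_rho_zero t τ l h htτ hlow (by linarith)
  -- the pourable mass `F = F₀`
  set F : ℝ := ∑ h ∈ Finset.range (N + 1), s h / U h with hF
  set F0 : ℝ := ∑ h ∈ Finset.range (N + 1), (if h ≤ j then f 0 h else 0) with hF0
  have hFF0 : F = F0 := by
    refine Finset.sum_congr rfl fun h _ => ?_
    simp only [hs, hUdef]
    by_cases hc : (h ≤ j ∧ 0 < f 0 h)
    · rw [if_pos hc, if_pos hc, if_pos hc.1]; field_simp [(hslotfacts h hc.1 hc.2).2.2.ne']
    · rw [if_neg hc, if_neg hc, zero_div]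
      by_cases hhj : h ≤ j
      · rw [if_pos hhj]
        have : ¬ 0 < f 0 h := fun hp => hc ⟨hhj, hp⟩
        linarith [hf0 0 h, not_lt.1 this]
      · rw [if_neg hhj]
  have hF00 : 0 ≤ F0 := Finset.sum_nonneg fun h _ => by split_ifs; exacts [hf0 0 h, le_rfl]
  -- giant mass of the transfer and the pour fraction
  set W : ℝ := ∑ l ∈ Finset.range (j + 1), ∑ g' ∈ Finset.Ico (j + 1) (N + 1), φ l g' with hW
  have hW0 : 0 ≤ W := Finset.sum_nonneg fun l _ => Finset.sum_nonneg fun g' _ => hφ0 l g'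
  set κ : ℝ := if W ≤ F0 then 1 else F0 / W with hκ
  have hκ0 : 0 ≤ κ := by simp only [hκ]; split_ifs with hc; exacts [zero_le_one, div_nonneg hF00 hW0]
  have hκ1 : κ ≤ 1 := by
    simp only [hκ]; split_ifs with hc
    · exact le_rfl
    · exact (div_le_one (lt_of_le_of_lt hF00 (not_le.1 hc))).2 (not_le.1 hc).le
  have hκF : κ * W ≤ F := by
    rw [hFF0]; simp only [hκ]; split_ifs with hc
    · rw [one_mul]; exact hc
    · rw [div_mul_cancel₀ _ (ne_of_gt (lt_of_le_of_lt hF00 (not_le.1 hc)))]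
  obtain ⟨φ', hφ', hW'⟩ := hφP0.pour hy0 hy1 s U hs0 hU hslot hspare hrate κ hκ0 hκ1 hκF
  -- (6) the zero-last principle
  have htaN : y * (N : ℝ) ≤ t := by rw [ht]; exact hta
  refine decAtT_of_zeroFreeRouting y t j N P φ' hy0 hy1 ht0 hP0 hPN hP1 htaN (by rw [hPmean, hP1, mul_one]) hφ' ?_
  by_cases hWF : W ≤ F0
  · left
    rw [hW']; simp only [hκ, if_pos hWF]; ring
  · right
    have hWpos : 0 < W := lt_of_le_of_lt hF00 (not_le.1 hWF)
    have hW'val : ∑ l ∈ Finset.range (j + 1), ∑ g' ∈ Finset.Ico (j + 1) (N + 1), φ' l g' = W - F0 := by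
      rw [hW']; simp only [hκ, if_neg hWF]; field_simp; ring
    rw [hW'val]
    -- bookkeeping: `P 0 + W − F0 ≤ Σ_l G_f l ≤ (1−y)/y · P(G)`
    set Gf : ℕ → ℝ := fun l => ∑ g' ∈ Finset.Ico (j + 1) (N + 1), f l g' with hGf
    -- (i) the zero row of `f`
    have hGfr : ∀ l, Gf l = ∑ h ∈ Finset.range (N + 1), (if j + 1 ≤ h then f l h else 0) := fun l => by
      simp only [hGf]; rw [sum_range_ite_ge_eq_Ico]
    have hzrow : Λ 0 = F0 + Gf 0 := by
      rw [hGfr 0, hF0, ← Finset.sum_add_distrib, ← hfrow 0 (Nat.zero_le _) (by simp; linarith)]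
      refine Finset.sum_congr rfl fun h _ => ?_
      by_cases hhj : h ≤ j
      · rw [if_pos hhj, if_neg (by omega), add_zero]
      · rw [if_neg hhj, if_pos (by omega), zero_add]
    -- (ii) the row of `a`: all on the giants
    have harow : Gf a = Λ a := by
      rw [hGfr a, ← hfrow a haj (by linarith)]
      refine Finset.sum_congr rfl fun h _ => ?_
      by_cases hh : j + 1 ≤ h
      · rw [if_pos hh]
      · rw [if_neg hh, hagiant h (by omega)]
    -- (iii) the transfer's giant mass
    have hWle : W ≤ (∑ l ∈ Finset.range (j + 1), Gf l) - Gf 0 - z * g := by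
      -- `P a / Λ a * Gf a = P a = Λ a − zg = Gf a − zg`
      have h5 : P a / Λ a * Gf a = Gf a - z * g := by
        rw [harow]
        rcases (hΛnn a).eq_or_lt with hz | hp
        · have hX : 0 ≤ (1 - z) * R a := mul_nonneg h1z.le (hR0 a)
          have hzg0 : z * g = 0 := le_antisymm (by linarith [hΛa]) hzg
          rw [← hz, hzg0, mul_zero, sub_zero]
        · rw [div_mul_cancel₀ _ hp.ne', hPΛa]
      -- row bounds
      have hrowb : ∀ l ∈ Finset.range (j + 1), ∑ g' ∈ Finset.Ico (j + 1) (N + 1), φ l g'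
          ≤ Gf l - (if l = 0 then Gf 0 else 0) - (if l = a then z * g else 0) := by
        intro l _
        by_cases hl0 : l = 0
        · subst hl0
          rw [if_pos rfl, if_neg (Ne.symm hane), Finset.sum_eq_zero (fun g' _ => hφzero g')]; ring_nf; exact le_rfl
        · rw [if_neg hl0]
          by_cases hla : l = a
          · subst hla
            rw [if_pos rfl, sub_zero, ← h5, hGf, Finset.mul_sum]
            refine Finset.sum_le_sum fun g' _ => ?_
            simp only [hφ]
            split_ifs
            · exact le_rfl
            · exact mul_nonneg (div_nonneg (hP0 l) (hΛnn l)) (hf0 l g')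
          · rw [if_neg hla, sub_zero, sub_zero, hGf]
            refine Finset.sum_le_sum fun g' _ => ?_
            simp only [hφ]
            split_ifs
            · rw [hΛP l hl0 hla]
              rcases (hP0 l).eq_or_lt with hz | hp
              · rw [← hz]; simp; exact hf0 l g'
              · rw [div_self hp.ne', one_mul]
            · exact hf0 l g'
      calc W ≤ ∑ l ∈ Finset.range (j + 1), (Gf l - (if l = 0 then Gf 0 else 0) - (if l = a then z * g else 0)) :=
            Finset.sum_le_sum hrowb
        _ = (∑ l ∈ Finset.range (j + 1), Gf l) - Gf 0 - z * g := by
            have e1 : ∑ l ∈ Finset.range (j + 1), (if l = 0 then Gf 0 else 0) = Gf 0 := by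
              rw [Finset.sum_eq_single_of_mem 0 (Finset.mem_range.2 (Nat.succ_pos j)) (fun l _ hl => if_neg hl), if_pos rfl]
            have e2 : ∑ l ∈ Finset.range (j + 1), (if l = a then z * g else 0) = z * g := by
              rw [Finset.sum_eq_single_of_mem a (Finset.mem_range.2 (by omega)) (fun l _ hl => if_neg hl), if_pos rfl]
            rw [Finset.sum_sub_distrib, Finset.sum_sub_distrib, e1, e2]
    -- (iv) the giants' capacity in `Λ`
    have hgiants : y / (1 - y) * ∑ l ∈ Finset.range (j + 1), Gf l ≤ ∑ g' ∈ Finset.Ico (j + 1) (N + 1), P g' := by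
      have hper : ∀ g' ∈ Finset.Ico (j + 1) (N + 1),
          y / (1 - y) * ∑ l ∈ Finset.range (j + 1), f l g' ≤ P g' := by
        intro g' hg'
        obtain ⟨hg1, hg2⟩ := Finset.mem_Ico.1 hg'
        have hc := hfcol g' (by omega) (Or.inl hg1)
        have e : ∑ l ∈ Finset.range (j + 1), usage y τ j l g' * f l g' = y / (1 - y) * ∑ l ∈ Finset.range (j + 1), f l g' := by
          rw [Finset.mul_sum]; exact Finset.sum_congr rfl fun l _ => by rw [usage_giant_eq y τ j l g' hg1]
        rw [e, hΛP g' (by omega) (by omega)] at hc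
        exact hc
      calc y / (1 - y) * ∑ l ∈ Finset.range (j + 1), Gf l
          = ∑ g' ∈ Finset.Ico (j + 1) (N + 1), y / (1 - y) * ∑ l ∈ Finset.range (j + 1), f l g' := by
            simp only [hGf]; rw [Finset.sum_comm, Finset.mul_sum]
        _ ≤ ∑ g' ∈ Finset.Ico (j + 1) (N + 1), P g' := Finset.sum_le_sum hper
    -- (v) assemble
    have hP0eq : P 0 = F0 + Gf 0 + z * g := by
      have e : P 0 = Λ 0 + z * g := by rw [hP00, hΛ0]; ring
      rw [e, hzrow]
    calc y / (1 - y) * (P 0 + (W - F0))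
        ≤ y / (1 - y) * ∑ l ∈ Finset.range (j + 1), Gf l :=
          mul_le_mul_of_nonneg_left (by rw [hP0eq]; linarith) huG.le
      _ ≤ ∑ g' ∈ Finset.Ico (j + 1) (N + 1), P g' := hgiants

end LawDec

end Quant

end Summit.CriticalPhenomena.PercolationContinuityZ3.Theorems
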